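import Summits.CriticalPhenomena.PercolationContinuityZ3.Theorems.PercNearOneGluingNoHeavyLowerTailQ44SingleSourceReduction
import Summits.CriticalPhenomena.PercolationContinuityZ3.Theorems.PercNearOneGluingNoHeavyLowerTailQ44SingleSourceBaseSchemes

/-!
# CORE A of the single-source packing reduces to the `K4s`-side kernel statement (WS)

Support file for crux `stmt-CriticalPhenomena-4575` (master-family programme, row `Q44`, single-source packing
`g ≥ b1 + h_a`), seat `prim-bnk-1` gen 30; memo `run/shared/lean/prim/prim-l12/FROM-prim-bnk-1-gen30-DENSE-FIBRES-WS.md`.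

`pack_singleSource_of_cores` (gen 28) derives the full single-source law from odd targets on two cores.  Gen 30 found, with
family-free linear algebra on dense fibres, that the gen-29 certificates for CORE A (kernels inside the MAXIMAL `K4s`-member,
`R7-W`; anchored schemes with that base) are false in general, and isolated the statement that does hold with no exception
in ≈ 4·10³ dense fibres (each standing for all `2^{#sides}` sub-families, up to 1044 sides):

**(WS)** in a fibre with an `a`-lobe, every family of sides of the four types `K1[ab|cy] (11,9)`, `K2[ab|cy] (11,8)`,
`K4[ab] (6,8)`, `K4s[ay|bc] (8,1)` that has a `K4s`-member admits a set `W ⊆ M` of co-cell `a|b|cy` (ANY `K4s`-side of the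
fibre, member or not) and a kernel `K ⊆ W` of cell `⊥` contained in an odd number of members.

This file proves that (WS) is exactly what CORE A needs:

* `exists_odd_good_coreA_of_WS` — in a fibre where (WS) holds, every family of the seven single-source types containing a
  `K4`- and a `K4s`-side and not in CORE B has an odd target (branches `Pb/¬K5`, `Pc/¬K1`, `K5/¬Pc` by the plain
  certificates of `…Q44SingleSourceOffCore`; the residual four-type family by (WS) and `exists_odd_good_of_sub_K4s`);
* `pack_singleSource_of_WS_coreB` — the full single-source law on `Fin n` from (WS) and the CORE-B statement in every
  fibre with an `a`-lobe.

No sorries, no definitions, standard axioms.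
-/

namespace Summit.CriticalPhenomena.PercolationContinuityZ3.Theorems

namespace TwoCopyMono

open Finset FourPointAtoms KernelPeeling Literature.Probability.Percolation

variable {n : ℕ}

/-- Table: the four core types are among the six non-`Pc` single-source types. [this work] -/
theorem four_subset_six :
    ∀ q ∈ ({(11, 9), (11, 8), (6, 8), (8, 1)} : Finset (Fin 15 × Fin 15)),
      q ∈ ({(6, 7), (11, 9), (11, 8), (6, 8), (6, 1), (8, 1)} : Finset (Fin 15 × Fin 15)) := by
  decide +kernel

/-- **CORE A from (WS).**  Graph fibre `(M, C)` with labelling `ι` in which the statement (WS) holds: every family of sides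
of the four types `K1[ab|cy], K2[ab|cy], K4[ab], K4s[ay|bc]` with a `K4s`-member has a kernel of cell `⊥` inside some
`W ⊆ M` of co-cell `a|b|cy`, contained in an odd number of members.  Then every family of the seven single-source types
that contains a `K4[ab]`- and a `K4s[ay|bc]`-side and does not lie in CORE B has an odd target among the goods of
`κ T = ι (T ∩ M)`. [this work] -/
theorem exists_odd_good_coreA_of_WS (a b c y : Fin n) (C M : Finset (Sym2 (Fin n)))
    (ι : Finset (Sym2 (Fin n)) → Fin 15) (hι : ∀ T : Finset (Sym2 (Fin n)), prof a b c y ↑(C ∪ T) = pp (ι T))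
    (hWS : ∀ 𝒮' : Finset (Finset (Sym2 (Fin n))), (∀ S ∈ 𝒮', S ⊆ M) →
      (∀ S ∈ 𝒮', (ι S, ι (M \ S)) ∈ ({(11, 9), (11, 8), (6, 8), (8, 1)} : Finset (Fin 15 × Fin 15))) →
      (∃ S ∈ 𝒮', (ι S, ι (M \ S)) = (8, 1)) →
      ∃ W : Finset (Sym2 (Fin n)), W ⊆ M ∧ ι (M \ W) = 1 ∧
        ∃ K : Finset (Sym2 (Fin n)), K ⊆ W ∧ ι K = 0 ∧ Odd #(𝒮'.filter (fun S => K ⊆ S)))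
    (𝒮 : Finset (Finset (Sym2 (Fin n)))) (h𝒮M : ∀ S ∈ 𝒮, S ⊆ M)
    (htypes : ∀ S ∈ 𝒮, (ι S, ι (M \ S)) ∈
      ({(6, 7), (5, 7), (11, 9), (11, 8), (6, 8), (6, 1), (8, 1)} : Finset (Fin 15 × Fin 15)))
    (hA : (∃ S ∈ 𝒮, (ι S, ι (M \ S)) = (6, 8)) ∧ (∃ S ∈ 𝒮, (ι S, ι (M \ S)) = (8, 1)))
    (hB : ¬ ((∃ S ∈ 𝒮, (ι S, ι (M \ S)) = (5, 7)) ∧ (∃ S ∈ 𝒮, (ι S, ι (M \ S)) = (11, 9)) ∧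
      (∃ S ∈ 𝒮, (ι S, ι (M \ S)) = (6, 1) ∨ (ι S, ι (M \ S)) = (6, 8)))) :
    ∃ T ∈ goods (fun T : Finset (Sym2 (Fin n)) => ι (T ∩ M)), Odd #(𝒮.filter (fun S => S ⊆ T)) := by
  classical
  have hmemP : ∀ S ∈ 𝒮, (ι S, ι (M \ S)) = (6, 7) ∨ (ι S, ι (M \ S)) = (5, 7) ∨ (ι S, ι (M \ S)) = (11, 9) ∨
      (ι S, ι (M \ S)) = (11, 8) ∨ (ι S, ι (M \ S)) = (6, 8) ∨ (ι S, ι (M \ S)) = (6, 1) ∨ (ι S, ι (M \ S)) = (8, 1) := by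
    intro S hS
    have h := htypes S hS
    simp only [Finset.mem_insert, Finset.mem_singleton] at h
    exact h
  have hpair : ∀ S (u v : Fin 15), (ι S, ι (M \ S)) = (u, v) ↔ ι S = u ∧ ι (M \ S) = v := by
    intro S u v; rw [Prod.mk.injEq]
  by_cases h1 : (∃ S ∈ 𝒮, (ι S, ι (M \ S)) = (6, 7)) ∧ ¬ ∃ S ∈ 𝒮, (ι S, ι (M \ S)) = (6, 1)
  · -- branch Pb
    obtain ⟨⟨S₁, hS₁, hS₁t⟩, hno5⟩ := h1
    refine exists_odd_good_of_maxType a b c y C M ι hι 𝒮 h𝒮M 6 7 ⟨S₁, hS₁, (hpair S₁ 6 7).1 hS₁t⟩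
      (fun S hS => tables_branch_Pb.1 _ (htypes S hS)) (fun S hS hle1 hle2 => ?_)
    rcases tables_branch_Pb.2 _ (htypes S hS) hle1 hle2 with h | h
    · exact (hpair S 6 7).1 h
    · exact absurd ⟨S, hS, h⟩ hno5
  · by_cases h2 : (∃ S ∈ 𝒮, (ι S, ι (M \ S)) = (5, 7)) ∧ ¬ ∃ S ∈ 𝒮, (ι S, ι (M \ S)) = (11, 9)
    · -- branch Pc
      obtain ⟨⟨S₁, hS₁, hS₁t⟩, hno1⟩ := h2
      refine exists_odd_good_of_maxType a b c y C M ι hι 𝒮 h𝒮M 5 7 ⟨S₁, hS₁, (hpair S₁ 5 7).1 hS₁t⟩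
        (fun S hS => tables_branch_Pc.1 _ (htypes S hS) (fun h => hno1 ⟨S, hS, h⟩))
        (fun S hS hle1 hle2 => (hpair S 5 7).1 (tables_branch_Pc.2 _ (htypes S hS) hle1 hle2))
    · by_cases h3 : (∃ S ∈ 𝒮, (ι S, ι (M \ S)) = (6, 1)) ∧ ¬ ∃ S ∈ 𝒮, (ι S, ι (M \ S)) = (5, 7)
      · -- branch K5
        obtain ⟨⟨S₁, hS₁, hS₁t⟩, hnoc⟩ := h3
        refine exists_odd_good_of_maxType a b c y C M ι hι 𝒮 h𝒮M 6 1 ⟨S₁, hS₁, (hpair S₁ 6 1).1 hS₁t⟩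
          (fun S hS => tables_branch_K5.1 _ (htypes S hS) (fun h => hnoc ⟨S, hS, h⟩))
          (fun S hS hle1 hle2 => (hpair S 6 1).1 (tables_branch_K5.2 _ (htypes S hS) hle1 hle2))
      · -- residual: a `K4`-side is present, so `Pc` would force CORE B; hence no `Pc`, no `K5`, no `Pb`
        have hK4 : ∃ S ∈ 𝒮, (ι S, ι (M \ S)) = (6, 8) := hA.1
        have hPc : ¬ ∃ S ∈ 𝒮, (ι S, ι (M \ S)) = (5, 7) := by
          intro hc
          have hK1 : ∃ S ∈ 𝒮, (ι S, ι (M \ S)) = (11, 9) := by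
            by_contra h; exact h2 ⟨hc, h⟩
          obtain ⟨S, hS, hSt⟩ := hK4
          exact hB ⟨hc, hK1, ⟨S, hS, Or.inr hSt⟩⟩
        have hnoK5 : ¬ ∃ S ∈ 𝒮, (ι S, ι (M \ S)) = (6, 1) := fun h => h3 ⟨h, hPc⟩
        have hnoPb : ¬ ∃ S ∈ 𝒮, (ι S, ι (M \ S)) = (6, 7) := fun h => h1 ⟨h, hnoK5⟩
        have hfour : ∀ S ∈ 𝒮, (ι S, ι (M \ S)) ∈ ({(11, 9), (11, 8), (6, 8), (8, 1)} : Finset (Fin 15 × Fin 15)) := by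
          intro S hS
          rcases hmemP S hS with h | h | h | h | h | h | h
          · exact absurd ⟨S, hS, h⟩ hnoPb
          · exact absurd ⟨S, hS, h⟩ hPc
          · rw [h]; decide
          · rw [h]; decide
          · rw [h]; decide
          · exact absurd ⟨S, hS, h⟩ hnoK5
          · rw [h]; decide
        obtain ⟨W, hWM, hWc, K, hKW, hK0, hodd⟩ := hWS 𝒮 h𝒮M hfour hA.2
        exact exists_odd_good_of_sub_K4s a b c y C M ι hι 𝒮 h𝒮M (fun S hS => four_subset_six _ (hfour S hS))
          W hWM hWc K hKW hK0 hodd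

/-- **The CORE hypothesis of `pack_singleSource_of_cores` from (WS) and CORE B, fibrewise.** [this work] -/
theorem coreTargets_of_WS_coreB (a b c y : Fin n) (M C : Finset (Sym2 (Fin n)))
    (ι : Finset (Sym2 (Fin n)) → Fin 15) (hι : ∀ T : Finset (Sym2 (Fin n)), prof a b c y ↑(C ∪ T) = pp (ι T))
    (hWS : ∀ 𝒮' : Finset (Finset (Sym2 (Fin n))), (∀ S ∈ 𝒮', S ⊆ M) →
      (∀ S ∈ 𝒮', (ι S, ι (M \ S)) ∈ ({(11, 9), (11, 8), (6, 8), (8, 1)} : Finset (Fin 15 × Fin 15))) →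
      (∃ S ∈ 𝒮', (ι S, ι (M \ S)) = (8, 1)) →
      ∃ W : Finset (Sym2 (Fin n)), W ⊆ M ∧ ι (M \ W) = 1 ∧
        ∃ K : Finset (Sym2 (Fin n)), K ⊆ W ∧ ι K = 0 ∧ Odd #(𝒮'.filter (fun S => K ⊆ S)))
    (hcoreB : ∀ 𝒮 : Finset (Finset (Sym2 (Fin n))), 𝒮.Nonempty → (∀ S ∈ 𝒮, S ⊆ M) →
      (∀ S ∈ 𝒮, (ι S, ι (M \ S)) ∈ ({(6, 7), (5, 7), (11, 9), (11, 8), (6, 8), (6, 1), (8, 1)} : Finset (Fin 15 × Fin 15))) →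
      ((∃ S ∈ 𝒮, (ι S, ι (M \ S)) = (5, 7)) ∧ (∃ S ∈ 𝒮, (ι S, ι (M \ S)) = (11, 9)) ∧
        (∃ S ∈ 𝒮, (ι S, ι (M \ S)) = (6, 1) ∨ (ι S, ι (M \ S)) = (6, 8))) →
      ∃ T ∈ goods (fun T : Finset (Sym2 (Fin n)) => ι (T ∩ M)), Odd #(𝒮.filter (fun S => S ⊆ T))) :
    ∀ 𝒮 : Finset (Finset (Sym2 (Fin n))), 𝒮.Nonempty → (∀ S ∈ 𝒮, S ⊆ M) →
      (∀ S ∈ 𝒮, (ι S, ι (M \ S)) ∈ ({(6, 7), (5, 7), (11, 9), (11, 8), (6, 8), (6, 1), (8, 1)} : Finset (Fin 15 × Fin 15))) →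
      (((∃ S ∈ 𝒮, (ι S, ι (M \ S)) = (6, 8)) ∧ (∃ S ∈ 𝒮, (ι S, ι (M \ S)) = (8, 1))) ∨
        ((∃ S ∈ 𝒮, (ι S, ι (M \ S)) = (5, 7)) ∧ (∃ S ∈ 𝒮, (ι S, ι (M \ S)) = (11, 9)) ∧
          (∃ S ∈ 𝒮, (ι S, ι (M \ S)) = (6, 1) ∨ (ι S, ι (M \ S)) = (6, 8)))) →
      ∃ T ∈ goods (fun T : Finset (Sym2 (Fin n)) => ι (T ∩ M)), Odd #(𝒮.filter (fun S => S ⊆ T)) := by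
  intro 𝒮 hne h𝒮M htypes hcore
  by_cases hB : (∃ S ∈ 𝒮, (ι S, ι (M \ S)) = (5, 7)) ∧ (∃ S ∈ 𝒮, (ι S, ι (M \ S)) = (11, 9)) ∧
      (∃ S ∈ 𝒮, (ι S, ι (M \ S)) = (6, 1) ∨ (ι S, ι (M \ S)) = (6, 8))
  · exact hcoreB 𝒮 hne h𝒮M htypes hB
  · rcases hcore with hA | hB'
    · exact exists_odd_good_coreA_of_WS a b c y C M ι hι hWS 𝒮 h𝒮M htypes hA hB
    · exact absurd hB' hB

/-- **The full single-source packing from (WS) and CORE B, all `n`.**  If, for the marked points `a b c y` of `Fin n`, in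
every graph fibre with an `a`-lobe (i) every family of `K1[ab|cy]/K2[ab|cy]/K4[ab]/K4s[ay|bc]`-sides with a `K4s`-member
has a cell-`⊥` kernel inside a set of co-cell `a|b|cy` with odd containment count, and (ii) every CORE-B family has an
odd target, then on every finite weighted graph on `Fin n`:
`P(ab|c|y)P(a|bcy) + P(ac|b|y)P(a|bcy) + P(ab|cy)P(ac|by) + P(ab|cy)P(ay|bc) + P(ab|c|y)P(ay|bc) + P(ab|c|y)P(a|b|cy) + P(ay|bc)P(a|b|cy)
 ≤ [P(ab|cy)+P(abcy)]·P(a|b|c|y)`. [this work] -/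
theorem pack_singleSource_of_WS_coreB (a b c y : Fin n)
    (hWS : ∀ (M C : Finset (Sym2 (Fin n))) (ι : Finset (Sym2 (Fin n)) → Fin 15),
      (∀ T : Finset (Sym2 (Fin n)), prof a b c y ↑(C ∪ T) = pp (ι T)) →
      (∃ T ∈ M.powerset, (ι T, ι (M \ T)) ∈ ({(6, 7), (5, 7)} : Finset (Fin 15 × Fin 15))) →
      ∀ 𝒮' : Finset (Finset (Sym2 (Fin n))), (∀ S ∈ 𝒮', S ⊆ M) →
        (∀ S ∈ 𝒮', (ι S, ι (M \ S)) ∈ ({(11, 9), (11, 8), (6, 8), (8, 1)} : Finset (Fin 15 × Fin 15))) →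
        (∃ S ∈ 𝒮', (ι S, ι (M \ S)) = (8, 1)) →
        ∃ W : Finset (Sym2 (Fin n)), W ⊆ M ∧ ι (M \ W) = 1 ∧
          ∃ K : Finset (Sym2 (Fin n)), K ⊆ W ∧ ι K = 0 ∧ Odd #(𝒮'.filter (fun S => K ⊆ S)))
    (hcoreB : ∀ (M C : Finset (Sym2 (Fin n))) (ι : Finset (Sym2 (Fin n)) → Fin 15),
      (∀ T : Finset (Sym2 (Fin n)), prof a b c y ↑(C ∪ T) = pp (ι T)) →
      (∃ T ∈ M.powerset, (ι T, ι (M \ T)) ∈ ({(6, 7), (5, 7)} : Finset (Fin 15 × Fin 15))) →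
      ∀ 𝒮 : Finset (Finset (Sym2 (Fin n))), 𝒮.Nonempty → (∀ S ∈ 𝒮, S ⊆ M) →
        (∀ S ∈ 𝒮, (ι S, ι (M \ S)) ∈ ({(6, 7), (5, 7), (11, 9), (11, 8), (6, 8), (6, 1), (8, 1)} : Finset (Fin 15 × Fin 15))) →
        ((∃ S ∈ 𝒮, (ι S, ι (M \ S)) = (5, 7)) ∧ (∃ S ∈ 𝒮, (ι S, ι (M \ S)) = (11, 9)) ∧
          (∃ S ∈ 𝒮, (ι S, ι (M \ S)) = (6, 1) ∨ (ι S, ι (M \ S)) = (6, 8))) →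
        ∃ T ∈ goods (fun T : Finset (Sym2 (Fin n)) => ι (T ∩ M)), Odd #(𝒮.filter (fun S => S ⊆ T)))
    (w : Sym2 (Fin n) → unitInterval) :
    cell w a b c y 6 * cell w a b c y 7 +
      cell w a b c y 5 * cell w a b c y 7 +
      cell w a b c y 11 * cell w a b c y 9 +
      cell w a b c y 11 * cell w a b c y 8 +
      cell w a b c y 6 * cell w a b c y 8 +
      cell w a b c y 6 * cell w a b c y 1 +
      cell w a b c y 8 * cell w a b c y 1 ≤
      (cell w a b c y 11 + cell w a b c y 14) * cell w a b c y 0 :=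
  pack_singleSource_of_cores a b c y
    (fun M C ι hι hlobe => coreTargets_of_WS_coreB a b c y M C ι hι (hWS M C ι hι hlobe) (hcoreB M C ι hι hlobe)) w

end TwoCopyMono

end Summit.CriticalPhenomena.PercolationContinuityZ3.Theorems
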